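import Mathlib.RingTheory.KrullDimension.Basic
import Mathlib.RingTheory.LocalRing.RingHom.Basic
import Mathlib.RingTheory.Ideal.GoingUp
import Mathlib.Algebra.CharP.Lemmas
import Literature.RingTheory.TightClosure.TightClosure
import Literature.RingTheory.KrullDimension.AffineDimension
import Summits.ResolutionOfSingularities.ResolutionOfSingularities.Theorems.FrobeniusLadderFRationalModificationFlatDescent
import HarnessLib

/-!
# A rung-2 ring below an F-rational Frobenius sandwich is rung-3
(crux `FrobeniusLadder.FRationalModification`, stmt-ResolutionOfSingularities-15316 — the easy
("top") half of idea card `artin-schreier-mirror-wild-core-collapse`'s first lemma `WildCoreCollapse`,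
and the sharpness companion of `Negative.RungTwoNotRungThree`)

The crux asks to pass from rung 2 (locally integral, Cohen–Macaulay, parameter ideals FROBENIUS closed)
to rung 3 (domain, parameter ideals TIGHTLY closed) by a modification. The disproof file shows that NO
modification is not an option in general (`Negative.localRungClimb_false`: the rung-2 ring
`W_p = 𝔽_p + X·𝔽_{p²}⟦X⟧` is not rung-3, although its normalisation `𝔽_{p²}⟦X⟧` is regular and
`W_p → 𝔽_{p²}⟦X⟧` is finite, birational and a homeomorphism on spectra). This file proves the positive
statement that sits exactly next to that witness: if a local ring `R` with Frobenius-closed parameter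
ideals lies UNDER an F-rational local domain `S` as a **Frobenius sandwich** — `R ⊆ S` and `S^q ⊆ R`
for some `q = p^e`, i.e. `Spec S → Spec R` is a finite universal homeomorphism of `𝔽_p`-schemes — then
`R` is already rung-3 (every parameter ideal satisfies the crux's tight-closure clause). Proof: a system
of parameters `s` of `R` stays one of `S` (integral extension: `dim S = dim R`, and `𝔪_S ⊆ rad(𝔪_R S)`
because `b^q ∈ 𝔪_R` for `b ∈ 𝔪_S`); if `c ≠ 0` and `c·y^Q ∈ (s)^[Q]` for all `Q` in `R`, the same
holds in `S`, so `y ∈ (s)S` by F-rationality of `S`, say `y = Σ aᵢ sᵢ`; raising to the `q`-th power,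
`y^q = Σ aᵢ^q sᵢ^q` with `aᵢ^q ∈ R`, so `y^q ∈ (s)^[q]` IN `R` (injectivity of `R → S`), and Frobenius
closedness of `(s)` in `R` gives `y ∈ (s)`. (For `W_p` the residue extension `𝔽_p ⊂ 𝔽_{p²}` is separable,
`ω^q ∉ W_p` for `ω ∈ 𝔽_{p²} ∖ 𝔽_p`: the sandwich hypothesis is what fails there, so it cannot be weakened
to "finite birational homeomorphism".) Consequence recorded by the idea card: no counterexample to the
crux can be manufactured from rung-2 models that are Frobenius sandwiches under F-rational (e.g.
regular) schemes — on that part of the "wild core" rung 3 is free.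

## References

* M. Hochster, C. Huneke, *F-regularity, test elements, and smooth base change*, Trans. AMS 346 (1994),
  §4 (F-rational rings; (4.1) persistence of tight closure). [HochsterHuneke1994]
* R. Fedder, K.-i. Watanabe, *A characterization of F-regularity in terms of F-purity*, MSRI Publ. 15
  (1989), Def. 1.10, Remark 1.9. [FedderWatanabe1989]
* N. Hara, T. Sawada, *Splitting of Frobenius sandwiches*, RIMS Kôkyûroku Bessatsu B24 (2011)
  (F-pure Frobenius sandwich surface singularities). [HaraSawada2011]
-/

-- single-problem summit: the doubled namespace component `ResolutionOfSingularities` is forced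
set_option linter.dupNamespace false

noncomputable section

open IsLocalRing Literature.RingTheory.TightClosure

namespace Summit.ResolutionOfSingularities.ResolutionOfSingularities.Theorems.FRationalModification.FrobeniusSandwich

/-- **A Frobenius sandwich is an integral extension**: if every `b ∈ S` has `b^(p^e)` in the image of
`R`, then `S` is integral over `R` (`b` is a root of `X^(p^e) − r`). [folklore] -/
theorem isIntegral_of_sandwich {R S : Type*} [CommRing R] [CommRing S] [Algebra R S] {p : ℕ}
    (hp : p.Prime) (e : ℕ) (hsand : ∀ b : S, b ^ p ^ e ∈ (algebraMap R S).range) :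
    Algebra.IsIntegral R S := by
  refine ⟨fun b => ?_⟩
  obtain ⟨r, hr⟩ := hsand b
  exact IsIntegral.of_pow (pow_pos hp.pos e) (hr ▸ isIntegral_algebraMap)

/-- **The closed fibre of a Frobenius sandwich of local rings is a point**: `𝔪_S ⊆ rad(𝔪_R S)`
(for `b ∈ 𝔪_S`, `b^q = r ∈ R` is a non-unit of `S`, hence `r ∈ 𝔪_R`). [folklore] -/
theorem maximalIdeal_le_radical_map_of_sandwich {R S : Type*} [CommRing R] [CommRing S]
    [IsLocalRing R] [IsLocalRing S] [Algebra R S] {p : ℕ} (hp : p.Prime) (e : ℕ)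
    (hsand : ∀ b : S, b ^ p ^ e ∈ (algebraMap R S).range) :
    maximalIdeal S ≤ ((maximalIdeal R).map (algebraMap R S)).radical := by
  intro b hb
  obtain ⟨r, hr⟩ := hsand b
  refine ⟨p ^ e, ?_⟩
  rw [← hr]
  refine Ideal.mem_map_of_mem _ ((mem_maximalIdeal _).mpr fun hu => ?_)
  have hbq : IsUnit (b ^ p ^ e) := hr ▸ hu.map (algebraMap R S)
  exact (mem_maximalIdeal b).mp hb ((isUnit_pow_iff (pow_ne_zero e hp.ne_zero)).mp hbq)

/-- **The maximal ideal contracts to the maximal ideal** along a Frobenius sandwich of local rings, so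
`R → S` is a local homomorphism. [folklore] -/
theorem isLocalHom_of_sandwich {R S : Type*} [CommRing R] [CommRing S]
    [IsLocalRing R] [IsLocalRing S] [Algebra R S] {p : ℕ} (hp : p.Prime) (e : ℕ)
    (hsand : ∀ b : S, b ^ p ^ e ∈ (algebraMap R S).range) :
    IsLocalHom (algebraMap R S) := by
  haveI : Algebra.IsIntegral R S := isIntegral_of_sandwich hp e hsand
  refine ⟨fun r hr => ?_⟩
  by_contra hru
  have hrm : r ∈ maximalIdeal R := (mem_maximalIdeal r).mpr hru
  -- `𝔪_S ∩ R` is a maximal ideal of `R`, hence `= 𝔪_R`, so `r ↦ 𝔪_S`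
  have hmax : ((maximalIdeal S).comap (algebraMap R S)).IsMaximal :=
    Ideal.isMaximal_comap_of_isIntegral_of_isMaximal (R := R) (maximalIdeal S)
  have heq : (maximalIdeal S).comap (algebraMap R S) = maximalIdeal R :=
    IsLocalRing.eq_maximalIdeal hmax
  have : r ∈ (maximalIdeal S).comap (algebraMap R S) := heq ▸ hrm
  exact (mem_maximalIdeal _).mp (Ideal.mem_comap.mp this) hr

/-- **A rung-2 ring under an F-rational Frobenius sandwich is rung-3.** Let `R ⊆ S` be local rings
with `R → S` injective and `S^(p^e) ⊆ R` (a Frobenius sandwich: `Spec S → Spec R` is a finite universal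
homeomorphism), `S` a domain of characteristic `p` all of whose ideals generated by a system of
parameters are tightly closed (F-rational), and suppose every ideal of `R` generated by a system of
parameters is Frobenius closed (the Frobenius half of the route's rung-2 clause). Then `R` is a domain
and every ideal of `R` generated by a system of parameters `s` satisfies the route's rung-3 clause:
`c ≠ 0` and `c·y^(p^e') ∈ (s)^[p^e']` for all `e'` force `y ∈ (s)`. Proof: `s` stays a system of
parameters of `S` (`dim S = dim R` for the integral extension; `𝔪_S ⊆ rad(𝔪_R S)`), the equations
persist in `S`, so `y ∈ (s)S`, `y = Σ aᵢ sᵢ`; then `y^q = Σ aᵢ^q sᵢ^q ∈ (s)^[q]` holds in `R` because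
`aᵢ^q ∈ R` and `R → S` is injective, and Frobenius closedness of `(s)` in `R` gives `y ∈ (s)`.
[cite: HochsterHuneke1994, (4.1) and Def. (4.1) of F-rational; FedderWatanabe1989, Remark 1.9] -/
theorem rungThree_of_frobeniusSandwich (p : ℕ) [Fact p.Prime] {R S : Type*} [CommRing R]
    [CommRing S] [IsLocalRing R] [IsLocalRing S] [IsDomain S] [CharP S p] [Algebra R S]
    (hinj : Function.Injective (algebraMap R S)) (e : ℕ)
    (hsand : ∀ b : S, b ^ p ^ e ∈ (algebraMap R S).range)
    (hR : ∀ d : ℕ, ringKrullDim R = d → ∀ s : Fin d → R,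
      (Ideal.span (Set.range s)).radical.IsMaximal → ∀ y : R,
        (∃ e' : ℕ, y ^ p ^ e' ∈
          Ideal.span ((fun z : R => z ^ p ^ e') '' (Ideal.span (Set.range s) : Set R))) →
        y ∈ Ideal.span (Set.range s))
    (hS : IsFRational S p) :
    IsDomain R ∧ ∀ d : ℕ, ringKrullDim R = d → ∀ s : Fin d → R,
      (Ideal.span (Set.range s)).radical.IsMaximal → ∀ y c : R, c ≠ 0 →
        (∀ e' : ℕ, c * y ^ p ^ e' ∈
          Ideal.span ((fun z : R => z ^ p ^ e') '' (Ideal.span (Set.range s) : Set R))) →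
        y ∈ Ideal.span (Set.range s) := by
  have hp : p.Prime := Fact.out
  haveI : Algebra.IsIntegral R S := isIntegral_of_sandwich hp e hsand
  haveI : IsLocalHom (algebraMap R S) := isLocalHom_of_sandwich hp e hsand
  have hdim : ringKrullDim S = ringKrullDim R :=
    (Literature.RingTheory.KrullDimension.ringKrullDim_eq_of_isIntegral hinj).symm
  have hfib : maximalIdeal S ≤ ((maximalIdeal R).map (algebraMap R S)).radical :=
    maximalIdeal_le_radical_map_of_sandwich hp e hsand
  refine ⟨Function.Injective.isDomain (algebraMap R S) hinj, ?_⟩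
  intro d hd s hs y c hc hmem
  set f := algebraMap R S with hf
  -- `s` is a system of parameters of `S`, so `(s)S` is tightly closed; the equations persist
  have hI : Ideal.span (Set.range (f ∘ s)) = (Ideal.span (Set.range s)).map f := by
    rw [Set.range_comp, ← Ideal.map_span]
  have htc := hS _ (FlatDescent.isSystemOfParameters_comp_algebraMap hdim hfib hd hs)
  rw [isTightlyClosed_iff_of_isDomain p, hI] at htc
  have hy : f y ∈ (Ideal.span (Set.range s)).map f :=
    htc _ (f c) ((map_ne_zero_iff _ hinj).mpr hc) fun e' =>
      FlatDescent.map_mem_span_pow_image f (p ^ e') _ (hmem e')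
  -- write `y = Σ aᵢ sᵢ` in `S`
  rw [← hI, Ideal.mem_span_range_iff_exists_fun] at hy
  obtain ⟨a, ha⟩ := hy
  -- `aᵢ^q ∈ R`
  have hsand' := fun i => hsand (a i)
  choose r hr using hsand'
  -- `y^q = Σ rᵢ sᵢ^q` holds in `R`, by injectivity of `R → S`
  have hyq : y ^ p ^ e = ∑ i, r i * s i ^ p ^ e := by
    apply hinj
    rw [map_pow, ← ha, sum_pow_char_pow p e, map_sum]
    refine Finset.sum_congr rfl fun i _ => ?_
    rw [Function.comp_apply, mul_pow, map_mul, map_pow, hr i]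
  -- hence `y^q ∈ (s)^[q]` in `R`, and Frobenius closedness concludes
  refine hR d hd s hs y ⟨e, ?_⟩
  rw [hyq]
  refine Ideal.sum_mem _ fun i _ => Ideal.mul_mem_left _ _ (Ideal.subset_span ?_)
  exact ⟨s i, Ideal.subset_span ⟨i, rfl⟩, rfl⟩

end Summit.ResolutionOfSingularities.ResolutionOfSingularities.Theorems.FRationalModification.FrobeniusSandwich

end
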